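import Mathlib
import Literature.Computability.AlgebraicComplexity.PermanentIrreducible
import Literature.Computability.AlgebraicComplexity.StandardFamiliesProofs

/-!
# Stub `stub_borderFanInOne` of crux `ChowBorderDepth3.ChowBorderBound`
# (stmt-ValiantsHypothesis-5936), line `registered`: the crux at top fan-in `r = 1`

For `n ≥ 2` and every `D`, `q`, a single product of `D` affine forms over `ℂ[ε]`
(`ε = Polynomial.X`, coefficient ring `Polynomial ℂ`) is never of the border shape
`ε^q · per_n + ε^(q+1) · G`: the padded permanent is not a border point of the Chow variety
`Ch_D` (the `r = 1` rung of the crux `ChowBorderBound`, for all `D` and `q`).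

## Proof

* ε-adic normalisation (`exists_eq_C_X_pow_mul`): every non-zero `p : MvPolynomial σ R[ε]` is
  `ε^e · p'` with `p'` non-zero modulo `ε` (`e` = the least `ε`-adic order of a coefficient of `p`),
  and `totalDegree p' ≤ totalDegree p`.
* Writing `ℓ_j = ε^(e_j) ℓ'_j`, the identity `Π_j ℓ_j = ε^q (per_n + ε G)` becomes
  `ε^E Π_j ℓ'_j = ε^q (per_n + ε G)` with `E = Σ_j e_j`.  Reducing modulo `ε` (the ring map
  `MvPolynomial.map Polynomial.constantCoeff`) after cancelling the smaller power of `ε`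
  (`map_constantCoeff_eq_zero_of_lt`) shows `E = q`, because both `Π_j ℓ'_j` and `per_n + ε G`
  are non-zero modulo `ε`; hence `Π_j (ℓ'_j mod ε) = per_n` over `ℂ`, a product of affine forms.
* `per_n` is irreducible (`perPoly_irreducible`, von zur Gathen 1987, Thm. 3.4) of total degree
  `n ≥ 2` (`totalDegree_perPoly_holds`), whereas an irreducible product of affine forms has total
  degree `≤ 1` (`totalDegree_le_one_of_irreducible_prod`: all factors but one are units, and units
  of `MvPolynomial σ ℂ` are constants).

References: J. M. Landsberg, *Geometry and complexity theory*, CUP 2017, §7.5 (border rank and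
the Chow variety); J. von zur Gathen, *Permanent and determinant*, Linear Algebra Appl. 96 (1987)
87–100, Thm. 3.4 (irreducibility of the permanent).
-/

noncomputable section

-- `Summit.ValiantsHypothesis.ValiantsHypothesis.…` is the tree's mandated single-conjunct layout
-- (Sub = Summit), so the duplicated namespace component is intended.
set_option linter.dupNamespace false

namespace Summit.ValiantsHypothesis.ValiantsHypothesis.Theorems.ChowBorderBound.BorderFanInOne

open MvPolynomial Literature.Computability.AlgebraicComplexity
open scoped Polynomial

/-! ## §1 ε-adic normalisation over `R[ε]` and reduction modulo `ε` -/

/-- **ε-adic normalisation.**  A non-zero polynomial with coefficients in `R[ε]` is `ε^e · p'` with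
`p'` non-zero modulo `ε` (take `e` the least `ε`-adic order of a coefficient and divide every
coefficient by `ε^e`), and `p'` has no larger total degree. [folklore] -/
theorem exists_eq_C_X_pow_mul {σ R : Type*} [CommSemiring R] (p : MvPolynomial σ R[X])
    (hp : p ≠ 0) :
    ∃ (e : ℕ) (p' : MvPolynomial σ R[X]), p = C (Polynomial.X ^ e) * p' ∧
      MvPolynomial.map Polynomial.constantCoeff p' ≠ 0 ∧ p'.totalDegree ≤ p.totalDegree := by
  classical
  obtain ⟨d₁, hd₁, hmin⟩ :=
    p.support.exists_min_image (fun d => (p.coeff d).natTrailingDegree) (support_nonempty.2 hp)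
  -- `e`: the least trailing degree (`ε`-adic order) of a coefficient, attained at `d₁`
  obtain ⟨e, he⟩ : ∃ e : ℕ, (p.coeff d₁).natTrailingDegree = e := ⟨_, rfl⟩
  -- every coefficient is divisible by `ε^e`
  have hdvd : ∀ d, (Polynomial.X : R[X]) ^ e ∣ p.coeff d := by
    intro d
    by_cases hd : d ∈ p.support
    · rw [Polynomial.X_pow_dvd_iff]
      intro k hk
      rw [← he] at hk
      exact Polynomial.coeff_eq_zero_of_lt_natTrailingDegree (lt_of_lt_of_le hk (hmin d hd))
    · rw [notMem_support_iff.1 hd]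
      exact dvd_zero _
  choose b hb using hdvd
  refine ⟨e, ∑ d ∈ p.support, monomial d (b d), ?_, ?_, ?_⟩
  · -- `p = ε^e · p'`
    rw [Finset.mul_sum]
    conv_lhs => rw [p.as_sum]
    refine Finset.sum_congr rfl fun d _ => ?_
    rw [C_mul_monomial, ← hb]
  · -- the coefficient of `p'` at `d₁` has non-zero constant term (the trailing coefficient)
    have hcoeff : coeff d₁ (∑ d ∈ p.support, monomial d (b d)) = b d₁ := by
      rw [coeff_sum, Finset.sum_eq_single d₁]
      · rw [coeff_monomial, if_pos rfl]
      · intro d _ hdd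
        rw [coeff_monomial, if_neg hdd]
      · intro h
        exact absurd hd₁ h
    intro h0
    have hc := congrArg (coeff d₁) h0
    rw [coeff_map, coeff_zero, hcoeff, Polynomial.constantCoeff_apply] at hc
    have htc : (p.coeff d₁).trailingCoeff ≠ 0 :=
      Polynomial.trailingCoeff_nonzero_iff_nonzero.2 (mem_support_iff.1 hd₁)
    apply htc
    rw [Polynomial.trailingCoeff, he, hb d₁, Polynomial.coeff_X_pow_mul', if_pos le_rfl,
      Nat.sub_self]
    exact hc
  · -- no new monomials
    exact totalDegree_finsetSum_le fun d hd =>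
      (totalDegree_monomial_le _ _).trans (le_totalDegree hd)

/-- Reduction modulo `ε` kills `ε^m` for `m > 0`. [folklore] -/
theorem map_constantCoeff_C_X_pow {σ R : Type*} [CommSemiring R] {m : ℕ} (hm : 0 < m) :
    MvPolynomial.map Polynomial.constantCoeff (C (Polynomial.X ^ m) : MvPolynomial σ R[X]) = 0 := by
  rw [map_C, Polynomial.constantCoeff_apply, Polynomial.coeff_X_pow, if_neg hm.ne, C_0]

/-- **Cancelling the smaller power of `ε`.**  If `ε^a · U = ε^b · V` with `a < b`, then `U` is
zero modulo `ε`. [folklore] -/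
theorem map_constantCoeff_eq_zero_of_lt {σ R : Type*} [CommRing R] [IsDomain R] {a b : ℕ}
    (hab : a < b) {U V : MvPolynomial σ R[X]}
    (h : C (Polynomial.X ^ a) * U = C (Polynomial.X ^ b) * V) :
    MvPolynomial.map Polynomial.constantCoeff U = 0 := by
  have hb : (Polynomial.X : R[X]) ^ b = Polynomial.X ^ a * Polynomial.X ^ (b - a) := by
    rw [← pow_add, Nat.add_sub_cancel' hab.le]
  rw [hb, map_mul C, mul_assoc] at h
  have hCa : (C (Polynomial.X ^ a) : MvPolynomial σ R[X]) ≠ 0 :=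
    C_ne_zero.2 (pow_ne_zero _ Polynomial.X_ne_zero)
  rw [mul_left_cancel₀ hCa h, map_mul, map_constantCoeff_C_X_pow (Nat.sub_pos_of_lt hab),
    zero_mul]

/-! ## §2 Irreducible products of affine forms -/

/-- Over `ℂ`, an irreducible product of affine polynomials has total degree `≤ 1`: all factors but
one are units, i.e. non-zero constants. [folklore] -/
theorem totalDegree_le_one_of_irreducible_prod {σ ι : Type*} (s : Finset ι)
    (f : ι → MvPolynomial σ ℂ) (hf : ∀ j ∈ s, (f j).totalDegree ≤ 1)
    (hirr : Irreducible (∏ j ∈ s, f j)) : (∏ j ∈ s, f j).totalDegree ≤ 1 := by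
  classical
  induction s using Finset.induction_on with
  | empty => rw [Finset.prod_empty, totalDegree_one]; exact zero_le_one
  | insert a s ha ih =>
    rw [Finset.prod_insert ha] at hirr ⊢
    refine (totalDegree_mul _ _).trans ?_
    rcases irreducible_mul_iff.1 hirr with ⟨-, hu⟩ | ⟨hirr', hu⟩
    · rw [(isUnit_iff_totalDegree_of_isReduced.1 hu).2, add_zero]
      exact hf a (Finset.mem_insert_self a s)
    · rw [(isUnit_iff_totalDegree_of_isReduced.1 hu).2, zero_add]
      exact ih (fun j hj => hf j (Finset.mem_insert_of_mem hj)) hirr'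

/-! ## §3 The stub -/

/-- **Stub `stub_borderFanInOne`** (registered stub of crux stmt-ValiantsHypothesis-5936, line
`registered`; the crux at top fan-in `r = 1`, for every `D` and `q`): for `n ≥ 2` no single
product of affine forms over `ℂ[ε]` equals `ε^q · per_n + ε^(q+1) · G`.  A border limit of a
product of affine forms is a product of affine forms (normalise each factor ε-adically and reduce
modulo `ε`), and `per_n` — irreducible of degree `n ≥ 2` — is not one. -/
theorem stub_borderFanInOne :
    ∀ n : ℕ, 2 ≤ n → ∀ (D q : ℕ) (ℓ : Fin D → MvPolynomial (Fin n × Fin n) (Polynomial ℂ))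
    (G : MvPolynomial (Fin n × Fin n) (Polynomial ℂ)), (∀ j, (ℓ j).totalDegree ≤ 1) →
    (∏ j, ℓ j) ≠
      MvPolynomial.C (Polynomial.X ^ q) *
          MvPolynomial.map Polynomial.C
            (Literature.Computability.AlgebraicComplexity.perPoly (Fin n) ℂ) +
        MvPolynomial.C (Polynomial.X ^ (q + 1)) * G := by
  intro n hn D q ℓ G hdeg heq
  classical
  have hCX : ∀ m : ℕ, (C (Polynomial.X ^ m) : MvPolynomial (Fin n × Fin n) ℂ[X]) ≠ 0 :=
    fun m => C_ne_zero.2 (pow_ne_zero _ Polynomial.X_ne_zero)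
  -- the border target is `ε^q · B` with `B ≡ per_n (mod ε)`
  obtain ⟨B, hB⟩ : ∃ B : MvPolynomial (Fin n × Fin n) ℂ[X],
      B = perPoly (Fin n) ℂ[X] + C Polynomial.X * G := ⟨_, rfl⟩
  have hT : C (Polynomial.X ^ q) * MvPolynomial.map Polynomial.C (perPoly (Fin n) ℂ) +
      C (Polynomial.X ^ (q + 1)) * G = C (Polynomial.X ^ q) * B := by
    rw [map_perPoly, hB, pow_succ, map_mul]
    ring
  have hredB : MvPolynomial.map Polynomial.constantCoeff B = perPoly (Fin n) ℂ := by
    rw [hB, map_add, map_perPoly, map_mul, ← pow_one (Polynomial.X : ℂ[X]),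
      map_constantCoeff_C_X_pow one_pos, zero_mul, add_zero]
  have hredB0 : MvPolynomial.map Polynomial.constantCoeff B ≠ 0 := by
    rw [hredB]
    exact perPoly_ne_zero _ _
  have hB0 : B ≠ 0 := fun h => hredB0 (by rw [h, map_zero])
  rw [hT] at heq
  -- every factor is non-zero: normalise it ε-adically, `ℓ_j = ε^(e_j) ℓ'_j`
  have hℓ0 : ∀ j, ℓ j ≠ 0 := by
    intro j hj
    have h0 : ∏ j, ℓ j = 0 := Finset.prod_eq_zero (Finset.mem_univ j) hj
    rw [h0] at heq
    exact mul_ne_zero (hCX q) hB0 heq.symm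
  choose e ℓ' hℓe hredℓ' hdegℓ' using fun j => exists_eq_C_X_pow_mul (ℓ j) (hℓ0 j)
  have hprod : ∏ j, ℓ j = C (Polynomial.X ^ ∑ j, e j) * ∏ j, ℓ' j := by
    calc ∏ j, ℓ j = ∏ j, (C (Polynomial.X ^ e j) * ℓ' j) :=
          Finset.prod_congr rfl fun j _ => hℓe j
      _ = C (Polynomial.X ^ ∑ j, e j) * ∏ j, ℓ' j := by
          rw [Finset.prod_mul_distrib, ← map_prod C, Finset.prod_pow_eq_pow_sum]
  rw [hprod] at heq
  have hredL0 : MvPolynomial.map Polynomial.constantCoeff (∏ j, ℓ' j) ≠ 0 := by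
    rw [map_prod]
    exact Finset.prod_ne_zero_iff.2 fun j _ => hredℓ' j
  -- comparing the powers of `ε`: `Σ_j e_j = q`, hence `Π_j (ℓ'_j mod ε) = per_n`
  have hEq : ∑ j, e j = q := by
    by_contra hne
    rcases lt_or_gt_of_ne hne with hlt | hgt
    · exact hredL0 (map_constantCoeff_eq_zero_of_lt hlt heq)
    · exact hredB0 (map_constantCoeff_eq_zero_of_lt hgt heq.symm)
  rw [hEq] at heq
  have hfin : ∏ j, MvPolynomial.map Polynomial.constantCoeff (ℓ' j) = perPoly (Fin n) ℂ := by
    rw [← map_prod, mul_left_cancel₀ (hCX q) heq, hredB]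
  -- the reduced normalised factors are affine
  have hdeg1 : ∀ j, (MvPolynomial.map Polynomial.constantCoeff (ℓ' j)).totalDegree ≤ 1 := by
    intro j
    calc (MvPolynomial.map Polynomial.constantCoeff (ℓ' j)).totalDegree
        ≤ (ℓ' j).totalDegree := by
          rw [totalDegree, totalDegree]
          exact Finset.sup_mono (support_map_subset _ _)
      _ ≤ (ℓ j).totalDegree := hdegℓ' j
      _ ≤ 1 := hdeg j
  -- `per_n` would be an irreducible product of affine forms over `ℂ`: degree contradiction
  haveI : Nonempty (Fin n) := ⟨⟨0, by omega⟩⟩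
  have hirr : Irreducible (∏ j, MvPolynomial.map Polynomial.constantCoeff (ℓ' j)) := by
    rw [hfin]
    exact perPoly_irreducible
  have h1 : (∏ j, MvPolynomial.map Polynomial.constantCoeff (ℓ' j)).totalDegree ≤ 1 := by
    apply totalDegree_le_one_of_irreducible_prod
    · intro j _
      exact hdeg1 j
    · exact hirr
  rw [hfin, totalDegree_perPoly_holds (n := Fin n) (k := ℂ), Fintype.card_fin] at h1
  omega

end Summit.ValiantsHypothesis.ValiantsHypothesis.Theorems.ChowBorderBound.BorderFanInOne

end
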